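import Summits.BirchSwinnertonDyer.BirchSwinnertonDyer.Theorems.KatoDescentPotSupersingularFineSelmerControl
import Summits.BirchSwinnertonDyer.BirchSwinnertonDyer.Theorems.KatoDescentPotSupersingularReducibleFineSelmerDescentCountSharp
import Literature.NumberTheory.EllipticCurves.FineSelmerCoefficientMapProofs
import Literature.NumberTheory.EllipticCurves.IwasawaSelmerControlKernelCardProofs
import Literature.NumberTheory.EllipticCurves.IwasawaTowerTorsionFiniteProofs
import Literature.NumberTheory.EllipticCurves.KatoFineSelmerDualProofs
import Literature.NumberTheory.EllipticCurves.IwasawaEulerCharDualityProofs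
import HarnessLib

/-!
# The fine Selmer group at LEVEL 0 versus the `Γ`-invariants of `Sel₀(K_∞, E[p^∞])`: restriction maps
# `Sel₀(K_n, E[p^∞])` into `Sel₀(K_∞, E[p^∞])`, and `#Sel₀(K, E[p^∞]) ∣ #E[p^∞]^{Γ_K} · #Sel₀(K_∞, E[p^∞])^{γ}`
# (kernel side of the fine control theorem; route `KatoDescentPotSupersingular` / `…Tame…`, crux M)

Seat `bsd-potss-rkm` g16 (prover; cell `bsd-potss`), item stmt-BirchSwinnertonDyer-19196 `ReducibleKatoMember` (crux M;
`--supports … --as helper`; closes nothing; ROUTE-FREE).  HONEST FRAMING: BSD is not proved by any of this; nothing is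
booked.  This is the level-`0` end of the fine-Selmer road to Kato's Thm. 14.5 (3) for crux M: the sibling files
`…ReducibleFineSelmerDescentCount[Sharp]` bound `#Sel₀(W/ℚ_∞)^Γ` by `#Sel₀(W/ℚ_∞)_Γ · [H¹(ℤ[1/p],T_pW) : ℤ_p𝐲₀]
/ #(descent cokernel)`; here the level-`0` fine Selmer group is bounded by `Sel₀(K_∞)^Γ` times the kernel of
restriction, `#ker(H¹(K, E[p^∞]) → H¹(K_∞, E[p^∞])) = #H¹(Γ, E(K_∞)[p^∞]) = #E(K)[p^∞]` (Greenberg, LNM 1716,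
proof of Lemma 4.3; tree theorem `natCard_ker_layerToInfty_eq_natCard_fixedPoints`; Lim 2020 Thm. 3.3, the
control theorem for fine Selmer groups: `ker r_n = ker h_n ∩ R(A/F_n)`).

WHAT (for EVERY number field `K`, prime `p`, model `W/K`, `ℤ_p`-extension `κ`; `M = E[p^∞] = W.geomPrimaryTorsion p`;
the level-`n` fine Selmer group is Greenberg's strict Selmer group of the fine data over `K_n = K̄^{κ⁻¹(pⁿℤ_p)}`,
`strictSelmerGroupOver (κ.layerSubgroup n) M p (fineData M p)`, the tree's definition `GreenbergSelmer.fineSelmerInfty`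
being the case `H = ker κ`):

* §1 `layerToInfty_mem_fineSelmerInfty` — **`h_n` maps `Sel₀(K_n, E[p^∞])` into `Sel₀(K_∞, E[p^∞])`** (restriction of a
  class locally trivial at every place of `K_n` is locally trivial at every place of `K_∞`; `res` commutes with
  `conj_σ`, `resOfLe_comp_conjH1`; transitivity `resOfLe_comp`; the fine condition at `v ∣ p` IS local triviality,
  `mem_strictKer_fineLocalDatum_iff`); `layerToInfty_mem_endInvariants` — at `n = 0` the image is `conj_γ`-fixed for
  EVERY `γ ∈ Γ_K` (inner automorphisms act trivially on `H¹(K, ·)`, `conjH1_of_mem`).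
* §3 **`natCard_fineSelmerZero_mul_descentCokernel_dvd_of_isEulerSystemClass_of_not_irreducible`** (and the
  zeta-lift / `∃` forms) — KATO'S THM. 14.5 (3) AT LEVEL 0 ON THE FINE ROAD, on the reducible non-CM rank-0 rows of
  crux M: `#Sel₀(ℚ, W[p^∞]) · #(H¹(ℤ[1/p],T_pW)/proj₀(𝐇¹_Γ/T)) ∣ #W[p^∞]^{Γ_ℚ} · #Sel₀(W/ℚ_∞)_Γ · [H¹(ℤ[1/p],T_pW) : ℤ_p·𝐲₀]`
  modulo {Kato 13.4, Serre, FW, Lim 3.5} (+ Z0 for the `∃`-form) — §2 composed with the sibling's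
  `natCard_fineSelmer_invariants_mul_descentCokernel_dvd_…`.  On Kato's objects this reads
  `#Sel₀^{str}(ℚ) · #𝐇²[T] ∣ #E(ℚ)[p^∞] · #Sel₀(ℚ_∞)_Γ · [H¹(ℤ[1/p],T) : z]`, the level-0 shadow of `#H²(ℤ[1/p],T) ≤ [H¹(ℤ[1/p],T) : z]`
  up to the one un-kernelised term `#Sel₀(W/ℚ_∞)_Γ` (memo FINDING-19196-rkm-g16: `= #Sel₀^Γ·#𝐇²[T]·p^{t₀−t_p}/#Sel₀^{ur}(ℚ)` via (14.14.2) + Poitou–Tate).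
* §2 **`natCard_fineSelmerZero_dvd`** — if `E(K_∞)[p^∞]` is finite then for every `γ ∈ Γ_K`
  `#Sel₀(K, E[p^∞]) ∣ #{m ∈ E[p^∞] | Γ_K·m = m} · #Sel₀(K_∞, E[p^∞])^{conj_γ}`
  (`#Sel₀(K) = #ker(h₀|Sel₀(K)) · #h₀(Sel₀(K))`, the kernel inside `ker h₀` of order `#E[p^∞]^{Γ_K}`, the image
  inside the `conj_γ`-invariants); `natCard_fineSelmerZero_dvd_rat` — over `ℚ` the finiteness is a theorem
  (`finite_fixedPoints_kerSubgroup_geomPrimaryTorsion_rat`, rkm g6).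

References: [GreenbergLNM1716] §3 Lemma 3.2, §4 Lemma 4.3 (p. 103); [Lim2020FineControl] = M. F. Lim, Doc. Math. 25
(2020) 2445–2471 (arXiv:2006.16447), Lemma 3.2 and Thm. 3.3 (control theorem for fine Selmer groups) — cite only, the
statements here are proved; [Greenberg1989] §1 p. 98 (strict Selmer groups); [CoatesSujatha2005] §3.
-/

-- the summit and its single problem are both named `BirchSwinnertonDyer` (registry layout D-0017)
set_option linter.dupNamespace false
set_option autoImplicit false

noncomputable section

open scoped NumberField
open Field IsDedekindDomain NumberField WeierstrassCurve
open Literature.NumberTheory.EllipticCurves Literature.NumberTheory.EllipticCurves.GreenbergSelmer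
open Literature.NumberTheory.EllipticCurves.IwasawaDual Literature.NumberTheory.EllipticCurves.FineSelmerCoefficientMap

universe u

namespace Summit.BirchSwinnertonDyer.BirchSwinnertonDyer.Theorems.ReducibleFineSelmerLevelZero

/-! ## §1 Restriction maps the level-`n` fine Selmer group into `Sel₀(K_∞, E[p^∞])` -/

section Map

variable {K : Type u} [Field K] [NumberField K] (W : WeierstrassCurve K) {p : ℕ} [Fact p.Prime]
  (κ : ZpExtension K p)

omit [NumberField K] [Fact p.Prime] in
/-- Transitivity of restriction through an intermediate subgroup, in the shape used below: for `H ≤ H'` and a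
subgroup `D`, `res_{H ⊓ D ≤ H} ∘ res_{H ≤ H'} = res_{H ⊓ D ≤ H' ⊓ D} ∘ res_{H' ⊓ D ≤ H'}` on `H¹(H', E[p^∞])`
(both are `res_{H ⊓ D ≤ H'}`, `resOfLe_comp`). [cite: NeukirchSchmidtWingberg2008, I.§5] -/
theorem resOfLe_inf_resOfLe_eq {H H' : Subgroup (absoluteGaloisGroup K)} (h : H ≤ H')
    (D : Subgroup (absoluteGaloisGroup K)) (y : W.subgroupH1 p H') :
    W.resOfLe p (inf_le_left : H ⊓ D ≤ H) (W.resOfLe p h y) =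
      W.resOfLe p (inf_le_inf_right D h : H ⊓ D ≤ H' ⊓ D) (W.resOfLe p (inf_le_left : H' ⊓ D ≤ H') y) := by
  have h1 := congrArg (fun f ↦ f y) (W.resOfLe_comp_holds p (inf_le_left : H ⊓ D ≤ H) h)
  have h2 := congrArg (fun f ↦ f y)
    (W.resOfLe_comp_holds p (inf_le_inf_right D h : H ⊓ D ≤ H' ⊓ D) (inf_le_left : H' ⊓ D ≤ H'))
  simp only [AddMonoidHom.coe_comp, Function.comp_apply] at h1 h2
  rw [h1, h2]

/-- **`h_n = res : H¹(K_n, E[p^∞]) → H¹(K_∞, E[p^∞])` maps `Sel₀(K_n, E[p^∞])` into `Sel₀(K_∞, E[p^∞])`**, for every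
number field `K`, prime `p`, `ℤ_p`-extension `κ` and `n`: each of the three local conditions of the fine (= strict,
`M⁺_v = 0`) Selmer group is the vanishing of a restriction to `H ⊓ D` (`awayKer`, `infKer`,
`mem_strictKer_fineLocalDatum_iff`), `conj_σ` commutes with restriction (`resOfLe_comp_conjH1`), and restriction is
transitive (`resOfLe_inf_resOfLe_eq`).  (Lim 2020, proof of Thm. 3.3: the map `r_n : R(A/F_n) → R(A/F_∞)^{Γ_n}` is
the restriction of `h_n`.) [cite: Greenberg1989, §1 p. 98] [cite: GreenbergLNM1716, §3 (the maps `s_n`, p. 86)] -/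
theorem layerToInfty_mem_fineSelmerInfty (n : ℕ) {y : W.subgroupH1 p (κ.layerSubgroup n)}
    (hy : y ∈ strictSelmerGroupOver (κ.layerSubgroup n) (W.geomPrimaryTorsion p) p
      (fineData (W.geomPrimaryTorsion p) p)) :
    W.layerToInfty κ n y ∈ W.fineSelmerInfty κ := by
  have hle : κ.kerSubgroup ≤ κ.layerSubgroup n := κ.kerSubgroup_le_layerSubgroup n
  obtain ⟨h1, h2, h3⟩ := (mem_strictSelmerGroupOver_iff (H := κ.layerSubgroup n)
    (M := W.geomPrimaryTorsion p) (L := fineData (W.geomPrimaryTorsion p) p) y).1 hy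
  -- `conj_σ (h_n y) = h_n (conj_σ y)`
  have hconj : ∀ σ : absoluteGaloisGroup K, W.conjH1 p κ.kerSubgroup σ (W.layerToInfty κ n y) =
      W.layerToInfty κ n (W.conjH1 p (κ.layerSubgroup n) σ y) := fun σ ↦ by
    have h := congrArg (fun f ↦ f y)
      (resOfLe_comp_conjH1_holds (M := W.geomPrimaryTorsion p) hle σ)
    simp only [AddMonoidHom.coe_comp, Function.comp_apply] at h
    exact h.symm
  refine (mem_strictSelmerGroupOver_iff (H := κ.kerSubgroup) (M := W.geomPrimaryTorsion p)
    (L := fineData (W.geomPrimaryTorsion p) p) _).2 ⟨fun v hv σ ↦ ?_, fun w σ ↦ ?_, fun v hv σ ↦ ?_⟩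
  · -- finite `v ∤ p`
    have h0 : W.resOfLe p (inf_le_left : κ.layerSubgroup n ⊓ decomp v ≤ κ.layerSubgroup n)
        (W.conjH1 p (κ.layerSubgroup n) σ y) = 0 := h1 v hv σ
    change W.resOfLe p (inf_le_left : κ.kerSubgroup ⊓ decomp v ≤ κ.kerSubgroup)
      (W.conjH1 p κ.kerSubgroup σ (W.layerToInfty κ n y)) = 0
    rw [hconj σ, WeierstrassCurve.layerToInfty, resOfLe_inf_resOfLe_eq W hle (decomp v), h0, map_zero]
  · -- infinite `w`
    have h0 : W.resOfLe p (inf_le_left : κ.layerSubgroup n ⊓ decompInf w ≤ κ.layerSubgroup n)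
        (W.conjH1 p (κ.layerSubgroup n) σ y) = 0 := h2 w σ
    change W.resOfLe p (inf_le_left : κ.kerSubgroup ⊓ decompInf w ≤ κ.kerSubgroup)
      (W.conjH1 p κ.kerSubgroup σ (W.layerToInfty κ n y)) = 0
    rw [hconj σ, WeierstrassCurve.layerToInfty, resOfLe_inf_resOfLe_eq W hle (decompInf w), h0, map_zero]
  · -- `v ∣ p`: the fine condition is local triviality at `H ⊓ D_v`
    have h3' : W.conjH1 p (κ.layerSubgroup n) σ y ∈
        (fineLocalDatum (W.geomPrimaryTorsion p) v).strictKer (κ.layerSubgroup n) := h3 v hv σ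
    have h0 : W.resOfLe p (inf_le_left : κ.layerSubgroup n ⊓ decomp v ≤ κ.layerSubgroup n)
        (W.conjH1 p (κ.layerSubgroup n) σ y) = 0 :=
      (mem_strictKer_fineLocalDatum_iff (M := W.geomPrimaryTorsion p) (κ.layerSubgroup n) v _).1 h3'
    change W.conjH1 p κ.kerSubgroup σ (W.layerToInfty κ n y) ∈
      (fineLocalDatum (W.geomPrimaryTorsion p) v).strictKer κ.kerSubgroup
    rw [mem_strictKer_fineLocalDatum_iff]
    change W.resOfLe p (inf_le_left : κ.kerSubgroup ⊓ decomp v ≤ κ.kerSubgroup)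
      (W.conjH1 p κ.kerSubgroup σ (W.layerToInfty κ n y)) = 0
    rw [hconj σ, WeierstrassCurve.layerToInfty, resOfLe_inf_resOfLe_eq W hle (decomp v), h0, map_zero]

/-- **At `n = 0` the image of `Sel₀(K, E[p^∞])` is fixed by every `conj_γ`** (`γ ∈ Γ_K = Gal(K̄/K_0)` acts trivially
on `H¹(K_0, ·)`, `conjH1_of_mem`; and `conj_γ ∘ h_0 = h_0 ∘ conj_γ`): `h_0(y) ∈ Sel₀(K_∞, E[p^∞])^{γ}`.
[cite: SerreLocalFields1979, VII.§5 Prop. 3] [cite: GreenbergLNM1716, §3 Lemma 3.2] -/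
theorem layerToInfty_mem_endInvariants (γ : absoluteGaloisGroup K) {y : W.subgroupH1 p (κ.layerSubgroup 0)}
    (hy : y ∈ strictSelmerGroupOver (κ.layerSubgroup 0) (W.geomPrimaryTorsion p) p
      (fineData (W.geomPrimaryTorsion p) p)) :
    (⟨W.layerToInfty κ 0 y, layerToInfty_mem_fineSelmerInfty W κ 0 hy⟩ : W.fineSelmerInfty κ) ∈
      endInvariants (W.conjFineSelmerInfty κ γ - 1) := by
  rw [endInvariants, AddMonoidHom.mem_ker]
  change (W.conjFineSelmerInfty κ γ - 1) ⟨W.layerToInfty κ 0 y, _⟩ = 0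
  rw [IwasawaDual.End_sub_apply, AddMonoid.End.one_apply, sub_eq_zero]
  apply Subtype.ext
  rw [W.coe_conjFineSelmerInfty_apply]
  change W.conjH1 p κ.kerSubgroup γ (W.layerToInfty κ 0 y) = W.layerToInfty κ 0 y
  have h := congrArg (fun f ↦ f y)
    (resOfLe_comp_conjH1_holds (M := W.geomPrimaryTorsion p) (κ.kerSubgroup_le_layerSubgroup 0) γ)
  simp only [AddMonoidHom.coe_comp, Function.comp_apply] at h
  change W.layerToInfty κ 0 (W.conjH1 p (κ.layerSubgroup 0) γ y) =
    W.conjH1 p κ.kerSubgroup γ (W.layerToInfty κ 0 y) at h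
  rw [← h, W.conjH1_of_mem_holds p (κ.layerSubgroup 0)
    (show γ ∈ κ.layerSubgroup 0 by rw [ZpExtension.layerSubgroup_zero]; exact Subgroup.mem_top γ),
    AddMonoidHom.id_apply]

end Map

/-! ## §2 `#Sel₀(K, E[p^∞]) ∣ #E[p^∞]^{Γ_K} · #Sel₀(K_∞, E[p^∞])^{γ}` -/

section Count

variable {K : Type u} [Field K] [NumberField K] (W : WeierstrassCurve K) {p : ℕ} [Fact p.Prime]
  (κ : ZpExtension K p)

/-- **Kernel side of the fine control theorem at level 0, counted.**  For every number field `K`, prime `p`, model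
`W/K`, `ℤ_p`-extension `κ` with `E(K_∞)[p^∞] = E[p^∞]^{ker κ}` finite, and every `γ ∈ Γ_K`:
`#Sel₀(K, E[p^∞]) ∣ #{m ∈ E[p^∞] | σ·m = m ∀ σ ∈ Γ_K} · #Sel₀(K_∞, E[p^∞])^{conj_γ}` — the restriction `h_0`
maps `Sel₀(K)` into `Sel₀(K_∞)^{conj_γ}` (§1) with kernel inside `ker h_0`, whose order is `#E[p^∞]^{Γ_K}`
(`natCard_ker_layerToInfty_eq_natCard_fixedPoints`, Greenberg's proof of Lemma 4.3); `Nat.card`, so the right-hand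
factor may be infinite (then it is `0`). [cite: GreenbergLNM1716, §4 Lemma 4.3 (p. 103)] [cite: Greenberg1989, §1 p. 98] -/
theorem natCard_fineSelmerZero_dvd [Finite (FixedPoints.addSubgroup κ.kerSubgroup (W.geomPrimaryTorsion p))]
    (γ : absoluteGaloisGroup K) :
    Nat.card (strictSelmerGroupOver (κ.layerSubgroup 0) (W.geomPrimaryTorsion p) p
        (fineData (W.geomPrimaryTorsion p) p)) ∣
      Nat.card {m : W.geomPrimaryTorsion p | ∀ σ ∈ κ.layerSubgroup 0, σ • m = m} *
        Nat.card (endInvariants (W.conjFineSelmerInfty κ γ - 1)) := by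
  set S₀ := strictSelmerGroupOver (κ.layerSubgroup 0) (W.geomPrimaryTorsion p) p
    (fineData (W.geomPrimaryTorsion p) p) with hS₀
  -- `h_0` restricted to `Sel₀(K)`, with values in `Sel₀(K_∞)^{conj_γ}`
  let f : S₀ →+ endInvariants (W.conjFineSelmerInfty κ γ - 1) :=
    { toFun := fun y ↦ ⟨⟨W.layerToInfty κ 0 y, layerToInfty_mem_fineSelmerInfty W κ 0 y.2⟩,
        layerToInfty_mem_endInvariants W κ γ y.2⟩
      map_zero' := Subtype.ext (Subtype.ext (by simp))
      map_add' := fun a b ↦ Subtype.ext (Subtype.ext (by simp)) }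
  -- its kernel embeds in `ker h_0`
  let g : f.ker →+ (W.layerToInfty κ 0).ker :=
    { toFun := fun y ↦ ⟨(y.1 : W.subgroupH1 p (κ.layerSubgroup 0)), by
        have hy : f y.1 = 0 := (AddMonoidHom.mem_ker).mp y.2
        rw [AddMonoidHom.mem_ker]
        have := congrArg (fun z : endInvariants (W.conjFineSelmerInfty κ γ - 1) ↦
          ((z : W.fineSelmerInfty κ) : W.subgroupH1 p κ.kerSubgroup)) hy
        simpa [f] using this⟩
      map_zero' := Subtype.ext rfl
      map_add' := fun a b ↦ Subtype.ext rfl }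
  have hg : Function.Injective g := fun a b hab ↦ by
    apply Subtype.ext; apply Subtype.ext
    exact congrArg (fun z : (W.layerToInfty κ 0).ker ↦ (z : W.subgroupH1 p (κ.layerSubgroup 0))) hab
  have hker : Nat.card f.ker ∣ Nat.card {m : W.geomPrimaryTorsion p | ∀ σ ∈ κ.layerSubgroup 0, σ • m = m} := by
    rw [← W.natCard_ker_layerToInfty_eq_natCard_fixedPoints κ 0]
    exact AddSubgroup.card_dvd_of_injective g hg
  have hrange : Nat.card f.range ∣ Nat.card (endInvariants (W.conjFineSelmerInfty κ γ - 1)) :=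
    AddSubgroup.card_addSubgroup_dvd_card f.range
  calc Nat.card S₀ = Nat.card f.ker * f.ker.index := (AddSubgroup.card_mul_index f.ker).symm
    _ = Nat.card f.ker * Nat.card f.range := by rw [AddSubgroup.index_ker f]
    _ ∣ _ := mul_dvd_mul hker hrange

/-- **Over `ℚ` the finiteness hypothesis is a theorem** (`E(ℚ_∞)[p^∞]` is finite for every `E/ℚ`, `p`, `ℤ_p`-extension
— `finite_fixedPoints_kerSubgroup_geomPrimaryTorsion_rat`, rkm g6): for every model `W/ℚ`, prime `p`, `κ`, `γ ∈ Γ_ℚ`,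
`#Sel₀(ℚ, W[p^∞]) ∣ #{m ∈ W[p^∞] | Γ_ℚ·m = m} · #Sel₀(ℚ_∞, W[p^∞])^{conj_γ}`.
[cite: GreenbergLNM1716, §4 Lemma 4.3 (p. 103)] [cite: SilvermanAEC2009, Prop. III.8.1] -/
theorem natCard_fineSelmerZero_dvd_rat (W : WeierstrassCurve ℚ) [W.IsElliptic] {p : ℕ} [Fact p.Prime]
    (κ : ZpExtension ℚ p) (γ : absoluteGaloisGroup ℚ) :
    Nat.card (strictSelmerGroupOver (κ.layerSubgroup 0) (W.geomPrimaryTorsion p) p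
        (fineData (W.geomPrimaryTorsion p) p)) ∣
      Nat.card {m : W.geomPrimaryTorsion p | ∀ σ ∈ κ.layerSubgroup 0, σ • m = m} *
        Nat.card (endInvariants (W.conjFineSelmerInfty κ γ - 1)) := by
  haveI := W.finite_fixedPoints_kerSubgroup_geomPrimaryTorsion_rat κ (p := p)
  exact natCard_fineSelmerZero_dvd W κ γ

end Count

/-! ## §3 Kato's Thm. 14.5 (3) at LEVEL 0 on the fine road (reducible non-CM rank-0 rows of crux M) -/

section LevelZero

open Literature.NumberTheory.GaloisRepresentations Literature.NumberTheory.EllipticCurves.Kato2004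
open Literature.NumberTheory.EllipticCurves.Kato2004.EulerSystemValues Literature.NumberTheory.EllipticCurves.ModularForms
open Literature.NumberTheory.EllipticCurves.IwasawaAlgebra CongruenceSubgroup
open scoped TensorProduct

variable (W : WeierstrassCurve ℚ) [W.IsElliptic] (p : ℕ) [Fact p.Prime]
  [ContinuousSMul ℤ_[p] (W.tateModule p)] [Module.Free ℤ_[p] (W.tateModule p)]
  [Module.Finite ℤ_[p] (W.tateModule p)]
  [Finite W.toAffine.Point] [Finite (AddCommGroup.primaryComponent W.sha p)]
  {κ : ZpExtension ℚ p} {γ : absoluteGaloisGroup ℚ}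

omit [W.IsElliptic] [ContinuousSMul ℤ_[p] (W.tateModule p)] [Module.Free ℤ_[p] (W.tateModule p)]
  [Module.Finite ℤ_[p] (W.tateModule p)] [Finite W.toAffine.Point]
  [Finite (AddCommGroup.primaryComponent W.sha p)] in
/-- Over the bottom layer `κ.layerSubgroup 0 = Γ_ℚ` the fixed points are the `Γ_ℚ`-fixed points `W[p^∞]^{Γ_ℚ} = W(ℚ)[p^∞]`.
[cite: GreenbergLNM1716, §4 Lemma 4.3 (p. 103)] -/
theorem setOf_fixed_layerZero_eq (κ : ZpExtension ℚ p) :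
    {m : W.geomPrimaryTorsion p | ∀ σ ∈ κ.layerSubgroup 0, σ • m = m} =
      {m : W.geomPrimaryTorsion p | ∀ σ : absoluteGaloisGroup ℚ, σ • m = m} := by
  ext m
  simp only [Set.mem_setOf_eq, ZpExtension.layerSubgroup_zero, Subgroup.mem_top, forall_const]

/-- **Kato Thm. 14.5 (3) AT LEVEL 0 on the fine road, reducible non-CM rank-0 rows.**  For `W/ℚ` elliptic non-CM, `p ≠ 2`,
`E[p]` reducible, `W(ℚ)` and `Ш(W)[p^∞]` finite, the cyclotomic `(κ, γ)`, pinned `I`, ANY dual fine Selmer datum `Y`, and a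
genuine Λ-adic Euler-system class `s ∈ 𝐇¹_Γ(T_pW)` with `proj₀ s` of infinite order:
**`#Sel₀(ℚ, W[p^∞]) · #(H¹(ℤ[1/p],T_pW)/proj₀(𝐇¹_Γ/T)) ∣ #W[p^∞]^{Γ_ℚ} · #Sel₀(W/ℚ_∞)_Γ · [H¹(ℤ[1/p],T_pW) : ℤ_p·s₀]`**
(level-0 fine Selmer group = Greenberg's strict Selmer group of the fine data over `Γ_ℚ`), modulo {`thm13_4_…`,
`serre_adicImage_…`, `ferreroWashington1979_…`, `Lim2017.thm35_…`}.  §2 (`#Sel₀(ℚ) ∣ #W[p^∞]^{Γ_ℚ} · #Sel₀(ℚ_∞)^Γ`)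
composed with `ReducibleFineSelmerDescentCount.natCard_fineSelmer_invariants_mul_descentCokernel_dvd_…`
(`#Sel₀(ℚ_∞)^Γ · #desc ∣ #Sel₀(ℚ_∞)_Γ · [A : s₀]`). [cite: Kato2004Asterisque, Thm. 14.5 (3) (p. 236), §14.14 (pp. 243–244)]
[cite: GreenbergLNM1716, §4 Lemmas 4.2–4.3 (pp. 102–103)] -/
theorem natCard_fineSelmerZero_mul_descentCokernel_dvd_of_isEulerSystemClass_of_not_irreducible
    (h134 : thm13_4_lengthAt_fineSelmerDual_le_of_isEulerSystemClass)
    (hSerre : serre_adicImage_contains_congruenceSubgroup)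
    (hLim : Lim2017.thm35_fineSelmerDual_moduleFinite_of_classicalMuVanishes_of_le_divisionField)
    (hFW : Literature.NumberTheory.IwasawaTheory.ferreroWashington1979_classicalMuVanishes)
    (hp : p ≠ 2) (hκ : κ.IsCyclotomic) (hγ : κ.IsTopGenerator γ) (hCM : ¬ W.HasCM)
    (hred : ¬ W.HasIrreducibleModPGaloisRep p) (I : IwasawaH1Data W p κ γ) (Y : W.FineSelmerDualData κ γ)
    (s : I.H) (hs : IsEulerSystemClass W p κ γ I s) (hnt : ¬ IsOfFinAddOrder (I.proj 0 s)) :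
    Nat.card (strictSelmerGroupOver (κ.layerSubgroup 0) (W.geomPrimaryTorsion p) p
        (fineData (W.geomPrimaryTorsion p) p)) * Nat.card I.descentCokernel ∣
      Nat.card {m : W.geomPrimaryTorsion p | ∀ σ : absoluteGaloisGroup ℚ, σ • m = m} *
        Nat.card (EndCoinvariants (W.conjFineSelmerInfty κ γ - 1)) *
          Nat.card (integralH1 (tateRep W p) p (κ.layerSubgroup 0) ⧸
            Submodule.span ℤ_[p] {(⟨I.proj 0 s, I.proj_mem 0 s⟩ :
              integralH1 (tateRep W p) p (κ.layerSubgroup 0))}) := by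
  have h1 := natCard_fineSelmerZero_dvd_rat W κ γ
  rw [setOf_fixed_layerZero_eq W p κ] at h1
  obtain ⟨-, -, -, -, h2⟩ :=
    ReducibleFineSelmerDescentCount.natCard_fineSelmer_invariants_mul_descentCokernel_dvd_of_isEulerSystemClass_of_not_irreducible
      W p h134 hSerre hLim hFW hp hκ hγ hCM hred I Y s hs hnt
  refine (mul_dvd_mul_right h1 _).trans ?_
  rw [mul_assoc, mul_assoc]
  exact mul_dvd_mul_left _ h2

/-- **The level-0 statement for KATO'S OWN zeta lift** (value-guarded `ZetaBody` family whose `f` is the newform of a curve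
`V` with `L(V,1) ≠ 0`; `𝐲₀` of infinite order from the VALUE, rkm g10):
`#Sel₀(ℚ, W[p^∞]) · #(H¹(ℤ[1/p],T_pW)/proj₀(𝐇¹_Γ/T)) ∣ #W[p^∞]^{Γ_ℚ} · #Sel₀(W/ℚ_∞)_Γ · [H¹(ℤ[1/p],T_pW) : ℤ_p·𝐲₀]`,
modulo {13.4, Serre, FW, Lim 3.5}. [cite: Kato2004Asterisque, Thm. 12.5 (p. 221), Thm. 14.5 (2)–(3) (p. 236), §14.14 (pp. 243–244)]
[cite: GreenbergLNM1716, §4 Lemmas 4.2–4.3 (pp. 102–103)] -/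
theorem natCard_fineSelmerZero_mul_descentCokernel_dvd_zetaLift
    (h134 : thm13_4_lengthAt_fineSelmerDual_le_of_isEulerSystemClass)
    (hSerre : serre_adicImage_contains_congruenceSubgroup)
    (hLim : Lim2017.thm35_fineSelmerDual_moduleFinite_of_classicalMuVanishes_of_le_divisionField)
    (hFW : Literature.NumberTheory.IwasawaTheory.ferreroWashington1979_classicalMuVanishes)
    (hp : p ≠ 2) (hκ : κ.IsCyclotomic) (hγ : κ.IsTopGenerator γ) (hCM : ¬ W.HasCM)
    (hred : ¬ W.HasIrreducibleModPGaloisRep p) (I : IwasawaH1Data W p κ γ) (Y : W.FineSelmerDualData κ γ)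
    {N : ℕ} [NeZero N] {f : CuspForm (Gamma0 N) 2}
    {ι : (m : ℕ) → (CyclotomicField m ℚ →+* ℂ)} {κ' : ℝ}
    {Λ' : ∀ (k : ℕ) (r : Finset (HeightOneSpectrum (𝓞 ℚ))),
      H1 (tateRep W p) (cycSubgroup p k r) →ₗ[ℤ_[p]] ℚ_[p] ⊗[ℚ] CyclotomicField (cycLevel p k r) ℚ}
    {c d a : ℤ} {A : ℕ}
    {z : ∀ (k : ℕ) (r : (cyclotomicLevelsRat p (badPlaces c d A N)).Ideals),
      H1 (tateRep W p) ((cyclotomicLevelsRat p (badPlaces c d A N)).level k r.1)}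
    {x : ∀ (k : ℕ) (r : (cyclotomicLevelsRat p (badPlaces c d A N)).Ideals),
      CyclotomicField (cycLevel p k r.1) ℚ}
    (hbody : ZetaBody W p f ι κ' Λ' c d a A z x) (hne : 2 * c.natAbs * d.natAbs * A * N ≠ 0)
    {y : I.H} (hy : ∀ n : ℕ, I.proj n y = levelToLayer W p hκ hp (badPlaces c d A N) n
      (z (n + 1) (cyclotomicLevelsRat p (badPlaces c d A N)).idealOne))
    {V : WeierstrassCurve ℚ} [V.IsElliptic] (hf : IsNewformOf V f) (hL1 : V.entireLFunction 1 ≠ 0)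
    (hκ' : κ' ≠ 0) (hA : 0 < A) (d' : ℤ) (hcd : Int.gcd (c * d) A = 1) (hdd' : d * d' ≡ 1 [ZMOD (A : ℤ)])
    (hR : cuspFactor f true (fun _ ↦ 1) c d a A d' ≠ 0) :
    Nat.card (strictSelmerGroupOver (κ.layerSubgroup 0) (W.geomPrimaryTorsion p) p
        (fineData (W.geomPrimaryTorsion p) p)) * Nat.card I.descentCokernel ∣
      Nat.card {m : W.geomPrimaryTorsion p | ∀ σ : absoluteGaloisGroup ℚ, σ • m = m} *
        Nat.card (EndCoinvariants (W.conjFineSelmerInfty κ γ - 1)) *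
          Nat.card (integralH1 (tateRep W p) p (κ.layerSubgroup 0) ⧸
            Submodule.span ℤ_[p] {(⟨I.proj 0 y, I.proj_mem 0 y⟩ :
              integralH1 (tateRep W p) p (κ.layerSubgroup 0))}) :=
  natCard_fineSelmerZero_mul_descentCokernel_dvd_of_isEulerSystemClass_of_not_irreducible W p h134 hSerre hLim hFW hp hκ
    hγ hCM hred I Y y (isEulerSystemClass_of_zetaBody W p hκ hp I hbody hne hy)
    (MemberIndexOfValue.not_isOfFinAddOrder_proj_zero_of_zetaBody hκ hp hbody hκ' hf hL1 hA d' hcd hdd' hR hy)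

/-- **Member-free `∃`-form over Z0 at level 0**: on every reducible non-CM rank-0 row with `L(W,1) ≠ 0` there is a non-zero
genuine Λ-adic Euler-system class `𝐲 ∈ 𝐇¹_Γ(T_pW)` with `𝐲₀` of infinite order and
`#Sel₀(ℚ, W[p^∞]) · #(H¹(ℤ[1/p],T_pW)/proj₀(𝐇¹_Γ/T)) ∣ #W[p^∞]^{Γ_ℚ} · #Sel₀(W/ℚ_∞)_Γ · [H¹(ℤ[1/p],T_pW) : ℤ_p·𝐲₀]`, modulo
{Z0, 13.4, Serre, FW, Lim 3.5}. [cite: Kato2004Asterisque, Thm. 12.5–12.6 (pp. 221–222), Thm. 13.4 (2) (p. 226), Thm. 14.5 (p. 236)]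
[cite: GreenbergLNM1716, §4 Lemmas 4.2–4.3 (pp. 102–103)] -/
theorem exists_zetaLift_natCard_fineSelmerZero_mul_descentCokernel_dvd
    (hZ0 : exists_member_eulerSystem_expStar_values)
    (h134 : thm13_4_lengthAt_fineSelmerDual_le_of_isEulerSystemClass)
    (hSerre : serre_adicImage_contains_congruenceSubgroup)
    (hLim : Lim2017.thm35_fineSelmerDual_moduleFinite_of_classicalMuVanishes_of_le_divisionField)
    (hFW : Literature.NumberTheory.IwasawaTheory.ferreroWashington1979_classicalMuVanishes)
    (hp : p ≠ 2) (hκ : κ.IsCyclotomic) (hγ : κ.IsTopGenerator γ) (hCM : ¬ W.HasCM)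
    (hred : ¬ W.HasIrreducibleModPGaloisRep p) (I : IwasawaH1Data W p κ γ) (Y : W.FineSelmerDualData κ γ)
    {N : ℕ} [NeZero N] (f : CuspForm (Gamma0 N) 2) (hf : IsNewformOf W f) (hL1 : W.entireLFunction 1 ≠ 0)
    (ι : (m : ℕ) → (CyclotomicField m ℚ →+* ℂ)) :
    ∃ y : I.H, y ≠ 0 ∧ IsEulerSystemClass W p κ γ I y ∧ ¬ IsOfFinAddOrder (I.proj 0 y) ∧
      Nat.card (strictSelmerGroupOver (κ.layerSubgroup 0) (W.geomPrimaryTorsion p) p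
          (fineData (W.geomPrimaryTorsion p) p)) * Nat.card I.descentCokernel ∣
        Nat.card {m : W.geomPrimaryTorsion p | ∀ σ : absoluteGaloisGroup ℚ, σ • m = m} *
          Nat.card (EndCoinvariants (W.conjFineSelmerInfty κ γ - 1)) *
            Nat.card (integralH1 (tateRep W p) p (κ.layerSubgroup 0) ⧸
              Submodule.span ℤ_[p] {(⟨I.proj 0 y, I.proj_mem 0 y⟩ :
                integralH1 (tateRep W p) p (κ.layerSubgroup 0))}) := by
  obtain ⟨y, hy0, hES, hnt, -⟩ :=
    ReducibleFineSelmerDescentCount.exists_zetaLift_natCard_fineSelmer_invariants_dvd_index W p hZ0 h134 hSerre hLim hFW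
      hp hκ hγ hCM hred I Y f hf hL1 ι
  exact ⟨y, hy0, hES, hnt,
    natCard_fineSelmerZero_mul_descentCokernel_dvd_of_isEulerSystemClass_of_not_irreducible W p h134 hSerre hLim hFW hp hκ
      hγ hCM hred I Y y hES hnt⟩

end LevelZero

end Summit.BirchSwinnertonDyer.BirchSwinnertonDyer.Theorems.ReducibleFineSelmerLevelZero

end
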